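import Literature.NumberTheory.Automorphic.ShimuraCurveCharacterGroupHeckeDictionary
import Literature.NumberTheory.Automorphic.ShimuraCurveTakahashiCoordinateInputs
import Literature.NumberTheory.Automorphic.BrandtEichlerLevelUOperators
import Summits.BirchSwinnertonDyer.BirchSwinnertonDyer.Theorems.RamifiedHeegnerPairLeafPartnerOrdersDictRankOne
import HarnessLib

/-!
# Route `RamifiedHeegnerPair`, crux U₁ `LeafRankOneUpperAtThree` (stmt-BirchSwinnertonDyer-26022), line `partnerdescent` —
# **the print stub DICT♭ is the named fact `shimuraCurve_characterGroupHeckeDictionary_disc` BY NAME**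

HONEST FRAMING. Theorems only; helper file (`--supports stmt-BirchSwinnertonDyer-26022`); a ONE-STEP instantiation of the cite-only
Literature named fact `Literature.NumberTheory.Automorphic.shimuraCurve_characterGroupHeckeDictionary_disc`
(‹ShimuraCurveCharacterGroupHeckeDictionary›, typed by this seat from Takahashi 2001 Prop. 3.1 ∕ Thm. 3.2 (a) ∕ p. 84, Helm 2007 Thm. 5.4 ∕
Cor. 5.3, Papikian–Rabinoff 2016 ¶23 + Lemma 24 — a `def … : Prop`, nothing asserted, net debt +1) at the binders of the v12 stub DICT♭
`Partnerdescent.LeafHeckeDictionaryReducedAtThree` (one text, two cruxes: U₁ 26022 `partnerdescent` v12, U₀ 26024 `splitkolyvagin0` v25). No number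
theory is proved here; no `sorry`; nothing booked; the crux stays OPEN and merely becomes conditional on one more NAMED print fact instead of a
lead-typed stub; BSD is proved for no curve. Lead prover bsd-line-rhp-p2 g67, 2026-08-31.

WHY. After v11 (HT derived, p817968) and v12 (Hecke stability p819076 and rank one p819594 derived), the stub DICT♭ was the line's last
lead-typed CONTENT stub on the Brandt side that is pure print: Ribet's exact sequence ∕ Takahashi's discriminant-side dictionary (adjunction for
Grothendieck's pairings with `c_p = ord_p Δ_min(W′)`, `q_* q^* = δ`, `q_*` onto, `Y` saturated, `q^* 1` on the `a(W′)`-eigen-lattice, `Y ≤ ℤ[Cls O]⁰`),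
(C2′) the new-projector (Jacquet–Langlands + strong multiplicity one) and (C5′) «optimal degree ∣ congruence» (Papikian–Rabinoff). The named fact
states exactly these clauses at the binders of the tree hypothesis `hDictDisc` (‹ShimuraCurveRibetTakahashiBrandtDictionaryProofs› §II) — i.e.
WITHOUT the stub's leaf-side hypotheses `3 ∤ N`, `ρ̄_{W,3}` irreducible, `W` split multiplicative at `d`, `d ≠ p`, which no source uses — and with
the degree-zero clauses written intrinsically (`Σ_c y_c = 0`) instead of through the stub's binder `(B, hB)`. The stub follows by weakening.

WHAT. `leafHeckeDictionaryReduced_of_print : shimuraCurve_characterGroupHeckeDictionary_disc → ‹DICT♭ text VERBATIM›` (the skeleton's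
`Partnerdescent.LeafHeckeDictionaryReducedAtThree` ∕ `Splitkolyvagin0.…` unfold to the conclusion definitionally), and the composite
`leafHeckeDictionary_of_print : takahashi2001_thm_2_3_shimura_disc → shimuraCurve_characterGroupHeckeDictionary_disc → ‹DICT text VERBATIM›`
over `leafHeckeDictionary_of_reduced₂` (‹…DictRankOne›, g66). Next skeletons (v13 ∕ v26): the stub `stub_leafHeckeDictionaryReduced` is DELETED,
the name joins the cite-only PRINT-ALL conjunction; 7 → 6 stubs, monotone.
-/

set_option linter.dupNamespace false
set_option autoImplicit false

noncomputable section

namespace Summit.BirchSwinnertonDyer.BirchSwinnertonDyer.Theorems.LeafPartnerOrders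

open scoped Pointwise Matrix
open Matrix Literature.NumberTheory.Automorphic Literature.NumberTheory.Automorphic.Brandt Literature.NumberTheory.EllipticCurves

/-- **DICT♭ from print, BY NAME**: the named fact `shimuraCurve_characterGroupHeckeDictionary_disc` instantiated at the binders of the v12 stub
`Partnerdescent.LeafHeckeDictionaryReducedAtThree` (statement VERBATIM the stub text; the leaf hypotheses at `3` and `d` are not used; the
degree-zero lattice `B` of the stub is `{v : Σ v = 0}` by `hB`, so the fact's intrinsic clauses (deg⁰) and (C2′) give `Y ≤ B` and `u_Y B ⊆ Y`).
[cite: Takahashi2001, Prop. 3.1 and Thm. 3.2 (a) (p. 82), p. 84] [cite: Helm2007, Thm. 5.4, Cor. 5.3] [cite: PapikianRabinoff2016, §3 ¶23, Lemma 24] -/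
theorem leafHeckeDictionaryReduced_of_print (hdict : shimuraCurve_characterGroupHeckeDictionary_disc) :
    ∀ {N D M p d : ℕ}, p.Prime → D = p * d → IsAdmissibleFactorization N D M →
      ∀ (X : ShimuraCurveData D M) (W : WeierstrassCurve ℚ) [W.IsElliptic] [W.IsGloballyMinimal],
        W.conductorNorm ℤ = N → ¬ 3 ∣ N → W.HasIrreducibleModPGaloisRep 3 →
      ∀ [Fact d.Prime], d ≠ p → W.HasSplitMultiplicativeReductionAtPrime d →
      ∀ (W' : WeierstrassCurve ℚ) [W'.IsElliptic] (P : ShimuraParametrizationData X W'), P.IsMinimalFor W →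
      ∀ (S : Brandt.XiSetup (p * M) d) [Fintype (ClassSet S.O)] [DecidableEq (ClassSet S.O)]
        (B : Submodule ℤ (ClassSet S.O → ℤ)), (∀ v, v ∈ B ↔ ∑ c, v c = 0) →
      ∃ (Y : Submodule ℤ (ClassSet S.O → ℤ)) (pb : ℤ →ₗ[ℤ] Y) (pf : Y →ₗ[ℤ] ℤ)
        (uY : Matrix (ClassSet S.O) (ClassSet S.O) ℤ) (N₀ : ℤ),
        (∀ (a : ℤ) (y : Y), ∑ k, (weight S.O k : ℤ) * (pb a : ClassSet S.O → ℤ) k * (y : ClassSet S.O → ℤ) k =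
          ((W'.minimalDiscriminantNorm ℤ).factorization p : ℤ) * a * pf y) ∧
        (∀ a : ℤ, pf (pb a) = (P.deg : ℤ) * a) ∧ Function.Surjective pf ∧
        (∀ (k : ℤ) (v : ClassSet S.O → ℤ), k ≠ 0 → k • v ∈ Y → v ∈ Y) ∧
        (pb 1 : ClassSet S.O → ℤ) ∈ eigenLattice (p * M * d) (Brandt.matrix S.O) (fun n ↦ W'.LFunction n) ∧
        Y ≤ B ∧
        uY ∈ S.fullHeckeAlgebra ∧ N₀ ≠ 0 ∧ (∀ y ∈ Y, uY *ᵥ y = N₀ • y) ∧ (∀ b ∈ B, uY *ᵥ b ∈ Y) ∧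
        (∀ C ∈ S.fullHeckeAlgebra, ∀ a : ℤ,
          (∀ y (hy : y ∈ Y), (P.deg : ℤ) • (C *ᵥ y) = a • pf ⟨y, hy⟩ • (pb 1 : ClassSet S.O → ℤ)) → (P.deg : ℤ) ∣ a) := by
  intro N D M p d hp hD hadm X W _ _ hN _ _ _ _ _ W' _ P hP S _ _ B hB
  obtain ⟨Y, pb, pf, uY, N₀, hadj, hδ, hsurj, hsat, hmem, hdeg, huT, hN₀, huY, huB, hC5⟩ :=
    hdict hp hD hadm X W hN W' P hP S
  refine ⟨Y, pb, pf, uY, N₀, hadj, hδ, hsurj, hsat, hmem, ?_, huT, hN₀, huY, ?_, hC5⟩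
  · intro y hy
    exact (hB y).mpr (hdeg y hy)
  · intro b hb
    exact huB b ((hB b).mp hb)

/-- **DICT from print, BY NAME** (the v11 stub text `Partnerdescent.LeafHeckeDictionaryAtThree` VERBATIM): the composite of
`leafHeckeDictionaryReduced_of_print` with g66's `leafHeckeDictionary_of_reduced₂` (rank one from `takahashi2001_thm_2_3_shimura_disc.xi_pos`, Hecke
stability from saturation + the new-projector + (HT)). Both inputs are cite-only named facts of the tree. [cite: Takahashi2001, §2 p. 78, Thm. 2.3, Prop. 3.1]
[cite: Helm2007, Thm. 5.4] [cite: PapikianRabinoff2016, §3 ¶23, Lemma 24] -/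
theorem leafHeckeDictionary_of_print (hdisc : takahashi2001_thm_2_3_shimura_disc)
    (hdict : shimuraCurve_characterGroupHeckeDictionary_disc) :
    ∀ {N D M p d : ℕ}, p.Prime → D = p * d → IsAdmissibleFactorization N D M →
      ∀ (X : ShimuraCurveData D M) (W : WeierstrassCurve ℚ) [W.IsElliptic] [W.IsGloballyMinimal],
        W.conductorNorm ℤ = N → ¬ 3 ∣ N → W.HasIrreducibleModPGaloisRep 3 →
      ∀ [Fact d.Prime], d ≠ p → W.HasSplitMultiplicativeReductionAtPrime d →
      ∀ (W' : WeierstrassCurve ℚ) [W'.IsElliptic] (P : ShimuraParametrizationData X W'), P.IsMinimalFor W →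
      ∀ (S : Brandt.XiSetup (p * M) d) [Fintype (ClassSet S.O)] [DecidableEq (ClassSet S.O)]
        (B : Submodule ℤ (ClassSet S.O → ℤ)), (∀ v, v ∈ B ↔ ∑ c, v c = 0) →
      ∃ (Y : Submodule ℤ (ClassSet S.O → ℤ)) (pb : ℤ →ₗ[ℤ] Y) (pf : Y →ₗ[ℤ] ℤ)
        (uY : Matrix (ClassSet S.O) (ClassSet S.O) ℤ) (N₀ : ℤ),
        (∀ (a : ℤ) (y : Y), ∑ k, (weight S.O k : ℤ) * (pb a : ClassSet S.O → ℤ) k * (y : ClassSet S.O → ℤ) k =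
          ((W'.minimalDiscriminantNorm ℤ).factorization p : ℤ) * a * pf y) ∧
        (∀ a : ℤ, pf (pb a) = (P.deg : ℤ) * a) ∧ Function.Surjective pf ∧
        (∀ (k : ℤ) (v : ClassSet S.O → ℤ), k ≠ 0 → k • v ∈ Y → v ∈ Y) ∧
        Module.finrank ℤ (eigenLattice (p * M * d) (Brandt.matrix S.O) (fun n ↦ W'.LFunction n)) = 1 ∧
        (pb 1 : ClassSet S.O → ℤ) ∈ eigenLattice (p * M * d) (Brandt.matrix S.O) (fun n ↦ W'.LFunction n) ∧
        Y ≤ B ∧ (∀ q : ℕ, q.Prime → ∀ y ∈ Y, S.heckeAt q *ᵥ y ∈ Y) ∧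
        uY ∈ S.fullHeckeAlgebra ∧ N₀ ≠ 0 ∧ (∀ y ∈ Y, uY *ᵥ y = N₀ • y) ∧ (∀ b ∈ B, uY *ᵥ b ∈ Y) ∧
        (∀ C ∈ S.fullHeckeAlgebra, ∀ a : ℤ,
          (∀ y (hy : y ∈ Y), (P.deg : ℤ) • (C *ᵥ y) = a • pf ⟨y, hy⟩ • (pb 1 : ClassSet S.O → ℤ)) → (P.deg : ℤ) ∣ a) :=
  fun hp hD hadm X W _ _ hN h3 hirr _ hdp hsplit W' _ P hP S _ _ B hB ↦
    leafHeckeDictionary_of_reduced₂ hdisc (leafHeckeDictionaryReduced_of_print hdict) hp hD hadm X W hN h3 hirr hdp hsplit W' P hP S B hB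

end Summit.BirchSwinnertonDyer.BirchSwinnertonDyer.Theorems.LeafPartnerOrders

end
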